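import Literature.Analysis.FluidPDE.PeriodicLerayLimitWeakForm
import Literature.Analysis.FluidPDE.PeriodicLerayMollifiedClasses
import Literature.Analysis.FluidPDE.PeriodicLerayLimitVelocity
import Literature.Analysis.FluidPDE.PeriodicLerayCompactness
import HarnessLib

/-!
# [BT1] proof of Theorem 2.4 — closure of the periodic weak formulation under `C¹` approximation

Analysis/FluidPDE proof file (theorems only; no definitions, no named facts) in the DAG below the
named fact `Literature.Analysis.FluidPDE.bradshawTsai2017_thm_2_4_mollified`
(`PeriodicLerayExistence.lean`; Bradshaw–Tsai, Ann. Henri Poincaré 18 (2017) = arXiv:1510.07504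
[BT1], proof of Thm 2.4: the weak formulation of the limit "holds for all `f ∈ 𝒟_T`"; Temam,
Ch. III §3, the density argument after (3.52)).

`periodWeakForm_of_approx`: for data `(U, ∇U)` in the classes of the limit (slices of finite
energy, `∇U` locally square integrable, `W ∈ C¹`, drift `η_ε * U`), the functional of clause
(iii) of `IsMollifiedPeriodicWeakSolution.weakForm`,
`Λ(f) = ∫₀ᵀ (∫ (⟪U, ∂ₛf⟫ − ∇U : ∇f + ⟪U + (∇U)y − (∇U)(W + η_ε*U) − DW U − DW W, f⟫) − ⟨LW, f⟩)`,
vanishes at `f ∈ 𝒟_T` as soon as it vanishes at test fields `g ∈ 𝒟_T` supported in a common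
ball and `C¹`-close to `f` (`|Λ(f) − Λ(g)| ≤ K δ` with `K` depending on the data and the ball
only: `Λ` is linear in the test field and every term is an `L¹` pairing on the cylinder).
Combined with `PeriodicLerayGalerkinTestApprox.exists_galerkin_test_approx_uniform` and
`PeriodicLerayGalerkinLimitWeakForm.periodWeakForm_of_limit` this gives clause (iii) for the
Galerkin limit.

## References

* Z. Bradshaw, T.-P. Tsai, Ann. Henri Poincaré 18 (2017) = arXiv:1510.07504, proof of Thm 2.4
  [BradshawTsai2017AHP].
* R. Temam, *Navier–Stokes equations* (1977/79), Ch. III §3 [Temam1979].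
-/

noncomputable section

open MeasureTheory Set Function Filter Topology TopologicalSpace Metric ContinuousLinearMap
open scoped NNReal ENNReal InnerProductSpace RealInnerProductSpace

namespace Literature.Analysis.FluidPDE

namespace BradshawTsai2017

section Closure

/-- `|x| ≤ K δ` for every `δ > 0` forces `x = 0`. [folklore] -/
theorem eq_zero_of_abs_le_mul_of_forall_pos {x K : ℝ} (h : ∀ δ : ℝ, 0 < δ → |x| ≤ K * δ) : x = 0 := by
  by_contra hx
  have hx' : 0 < |x| := abs_pos.2 hx
  by_cases hK : K ≤ 0
  · have := h 1 one_pos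
    nlinarith
  · push Not at hK
    have := h (|x| / (2 * K)) (by positivity)
    have e : K * (|x| / (2 * K)) = |x| / 2 := by field_simp
    linarith

/-- `|A : B| ≤ 3 ‖A‖ ‖B‖` for the Frobenius pairing on `ℝ³`. [folklore] -/
theorem abs_frobeniusInner_le (A B : EuclideanSpace ℝ (Fin 3) →L[ℝ] EuclideanSpace ℝ (Fin 3)) : |frobeniusInner A B| ≤ 3 * ‖A‖ * ‖B‖ := by
  have he1 : ∀ i, ‖stdOrthonormalBasis ℝ (EuclideanSpace ℝ (Fin 3)) i‖ = 1 := fun i =>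
    (stdOrthonormalBasis ℝ (EuclideanSpace ℝ (Fin 3))).orthonormal.1 i
  have hi : ∀ i, |⟪A (stdOrthonormalBasis ℝ (EuclideanSpace ℝ (Fin 3)) i), B (stdOrthonormalBasis ℝ (EuclideanSpace ℝ (Fin 3)) i)⟫| ≤ ‖A‖ * ‖B‖ := by
    intro i
    have h1 : ‖A (stdOrthonormalBasis ℝ (EuclideanSpace ℝ (Fin 3)) i)‖ ≤ ‖A‖ := by
      simpa [he1 i] using A.le_opNorm (stdOrthonormalBasis ℝ (EuclideanSpace ℝ (Fin 3)) i)
    have h2 : ‖B (stdOrthonormalBasis ℝ (EuclideanSpace ℝ (Fin 3)) i)‖ ≤ ‖B‖ := by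
      simpa [he1 i] using B.le_opNorm (stdOrthonormalBasis ℝ (EuclideanSpace ℝ (Fin 3)) i)
    exact (abs_real_inner_le_norm _ _).trans (mul_le_mul h1 h2 (norm_nonneg _) (norm_nonneg _))
  simp only [frobeniusInner]
  calc |∑ i, ⟪A (stdOrthonormalBasis ℝ (EuclideanSpace ℝ (Fin 3)) i), B (stdOrthonormalBasis ℝ (EuclideanSpace ℝ (Fin 3)) i)⟫|
      ≤ ∑ i, |⟪A (stdOrthonormalBasis ℝ (EuclideanSpace ℝ (Fin 3)) i), B (stdOrthonormalBasis ℝ (EuclideanSpace ℝ (Fin 3)) i)⟫| :=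
        Finset.abs_sum_le_sum_abs _ _
    _ ≤ ∑ _i : Fin (Module.finrank ℝ (EuclideanSpace ℝ (Fin 3))), ‖A‖ * ‖B‖ := Finset.sum_le_sum fun i _ => hi i
    _ = 3 * ‖A‖ * ‖B‖ := by
        simp only [Finset.sum_const, Finset.card_univ, Fintype.card_fin, finrank_euclideanSpace,
          nsmul_eq_mul, Nat.cast_ofNat]
        ring

/-- The Frobenius pairing is additive in the second argument. [folklore] -/
theorem frobeniusInner_sub_right (A B B' : EuclideanSpace ℝ (Fin 3) →L[ℝ] EuclideanSpace ℝ (Fin 3)) :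
    frobeniusInner A (B - B') = frobeniusInner A B - frobeniusInner A B' := by
  simp only [frobeniusInner, _root_.sub_apply, inner_sub_right, Finset.sum_sub_distrib]

/-- The Frobenius pairing is jointly continuous. [folklore] -/
theorem continuous_frobeniusInner_uncurry :
    Continuous fun p : (EuclideanSpace ℝ (Fin 3) →L[ℝ] EuclideanSpace ℝ (Fin 3)) × (EuclideanSpace ℝ (Fin 3) →L[ℝ] EuclideanSpace ℝ (Fin 3)) => frobeniusInner p.1 p.2 := by
  simp only [frobeniusInner]
  refine continuous_finsetSum _ fun i _ => ?_
  exact ((ContinuousLinearMap.apply ℝ (EuclideanSpace ℝ (Fin 3)) (stdOrthonormalBasis ℝ (EuclideanSpace ℝ (Fin 3)) i)).continuous.comp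
    continuous_fst).inner (((ContinuousLinearMap.apply ℝ (EuclideanSpace ℝ (Fin 3)) (stdOrthonormalBasis ℝ (EuclideanSpace ℝ (Fin 3)) i)).continuous.comp
    continuous_snd))

set_option maxHeartbeats 1600000 in
/-- **Closure of the periodic weak formulation under `C¹` approximation of the test field**
([BT1], proof of Thm 2.4; Temam Ch. III §3). See the module docstring. [cite: BradshawTsai2017AHP, proof of Thm 2.4 ("holds for all f ∈ 𝒟_T"); Temam1979, Ch. III §3] -/
theorem periodWeakForm_of_approx {T : ℝ} (hT : 0 < T)
    {W : ℝ → EuclideanSpace ℝ (Fin 3) → EuclideanSpace ℝ (Fin 3)} (hW : ContDiff ℝ 1 (uncurry W))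
    {η : EuclideanSpace ℝ (Fin 3) → ℝ} (hη : IsMollifyingKernel η) {ε : ℝ} (hε : 0 < ε)
    {Ul : ℝ → EuclideanSpace ℝ (Fin 3) → EuclideanSpace ℝ (Fin 3)}
    (hUlm : AEStronglyMeasurable (uncurry Ul) (volume : Measure (ℝ × EuclideanSpace ℝ (Fin 3))))
    {CE : ℝ≥0} (hUlE : ∀ᵐ s : ℝ, ∫⁻ y, ‖Ul s y‖ₑ ^ 2 ≤ CE)
    (hUlfin : ∀ n : ℕ, ∫⁻ z in Ioo (-((n : ℝ) + 1)) ((n : ℝ) + 1) ×ˢ ball (0 : EuclideanSpace ℝ (Fin 3)) (n + 1),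
      ‖Ul z.1 z.2‖ₑ ^ 2 < ∞)
    {Gu : ℝ → EuclideanSpace ℝ (Fin 3) → EuclideanSpace ℝ (Fin 3) →L[ℝ] EuclideanSpace ℝ (Fin 3)}
    (hGu : HasWeakSpatialGradientOn (⊤ : Opens (ℝ × EuclideanSpace ℝ (Fin 3))) Ul Gu)
    (hGub : ∀ m : ℕ, ∫⁻ z in Ioo (-((m : ℝ) + 1)) ((m : ℝ) + 1) ×ˢ (univ : Set (EuclideanSpace ℝ (Fin 3))),
      ENNReal.ofReal (frobeniusNormSq (Gu z.1 z.2)) < ∞)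
    {f : ℝ → EuclideanSpace ℝ (Fin 3) → EuclideanSpace ℝ (Fin 3)} (hf : IsPeriodicDivFreeTest T f) {R : ℝ} (hR0 : 0 < R)
    (hfR : ∀ s y, R ≤ ‖y‖ → f s y = 0)
    (happrox : ∀ δ : ℝ, 0 < δ → ∃ g : ℝ → EuclideanSpace ℝ (Fin 3) → EuclideanSpace ℝ (Fin 3), IsPeriodicDivFreeTest T g ∧
      (∀ s y, R ≤ ‖y‖ → g s y = 0) ∧
      (∀ s y, ‖f s y - g s y‖ ≤ δ ∧ ‖fderiv ℝ (f s) y - fderiv ℝ (g s) y‖ ≤ δ ∧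
        ‖timeDeriv f s y - timeDeriv g s y‖ ≤ δ) ∧
      ∫ s in Ioo 0 T, ((∫ y, (⟪Ul s y, timeDeriv g s y⟫ -
          frobeniusInner (Gu s y) (fderiv ℝ (g s) y) +
          ⟪Ul s y + Gu s y y - Gu s y (W s y + mollify η ε Ul s y) -
            fderiv ℝ (W s) y (Ul s y) - fderiv ℝ (W s) y (W s y), g s y⟫)) -
        lerayPairing W s (g s)) = 0) :
    ∫ s in Ioo 0 T, ((∫ y, (⟪Ul s y, timeDeriv f s y⟫ -
          frobeniusInner (Gu s y) (fderiv ℝ (f s) y) +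
          ⟪Ul s y + Gu s y y - Gu s y (W s y + mollify η ε Ul s y) -
            fderiv ℝ (W s) y (Ul s y) - fderiv ℝ (W s) y (W s y), f s y⟫)) -
        lerayPairing W s (f s)) = 0 := by
  have happ : Continuous (uncurry fun (L : EuclideanSpace ℝ (Fin 3) →L[ℝ] EuclideanSpace ℝ (Fin 3)) (v : EuclideanSpace ℝ (Fin 3)) => L v) :=
    isBoundedBilinearMap_apply.continuous
  -- ## the cylinder `(0,T) × B(0,R)`
  set I : Set ℝ := Ioo 0 T with hI
  set B : Set (EuclideanSpace ℝ (Fin 3)) := ball (0 : EuclideanSpace ℝ (Fin 3)) (R + 1) with hB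
  set S : Set (ℝ × EuclideanSpace ℝ (Fin 3)) := I ×ˢ B with hS
  have hSm : MeasurableSet S := measurableSet_Ioo.prod measurableSet_ball
  haveI hfinQ : IsFiniteMeasure (volume.restrict S) :=
    NSCylinder.isFiniteMeasure_restrict (Ω := ⟨ball (0 : EuclideanSpace ℝ (Fin 3)) (R + 1), isOpen_ball⟩) isBounded_ball 0 T
  set μQ : Measure (ℝ × EuclideanSpace ℝ (Fin 3)) := volume.restrict S with hμQ
  set n : ℕ := ⌈max T (R + 1)⌉₊ with hn
  have hTn : T ≤ (n : ℝ) + 1 := ((le_max_left T (R + 1)).trans (Nat.le_ceil _)).trans (le_add_of_nonneg_right zero_le_one)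
  have hRn : R + 1 ≤ (n : ℝ) + 1 := ((le_max_right T (R + 1)).trans (Nat.le_ceil _)).trans (le_add_of_nonneg_right zero_le_one)
  have hSQ : S ⊆ Ioo (-((n : ℝ) + 1)) ((n : ℝ) + 1) ×ˢ ball (0 : EuclideanSpace ℝ (Fin 3)) (n + 1) := fun z hz =>
    ⟨⟨by linarith [hz.1.1, (Nat.cast_nonneg n : (0 : ℝ) ≤ n)], hz.1.2.trans_le hTn⟩, ball_subset_ball hRn hz.2⟩
  have hSslab : S ⊆ Ioo (-((n : ℝ) + 1)) ((n : ℝ) + 1) ×ˢ (univ : Set (EuclideanSpace ℝ (Fin 3))) := fun z hz =>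
    ⟨(hSQ hz).1, mem_univ _⟩
  -- ## the profile on the cylinder
  obtain ⟨M, hM0, hMW, -⟩ := exists_profile_bound hW 0 T (0 : EuclideanSpace ℝ (Fin 3)) (R + 1)
  have cW : Continuous fun z : ℝ × EuclideanSpace ℝ (Fin 3) => W z.1 z.2 := hW.continuous
  have cWt : Continuous fun z : ℝ × EuclideanSpace ℝ (Fin 3) => timeDeriv W z.1 z.2 := continuous_timeDeriv_of_contDiff_one hW
  have cDW : Continuous fun z : ℝ × EuclideanSpace ℝ (Fin 3) => fderiv ℝ (W z.1) z.2 := continuous_fderiv_slice_of_contDiff hW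
  have cDWy : Continuous fun z : ℝ × EuclideanSpace ℝ (Fin 3) => fderiv ℝ (W z.1) z.2 z.2 := happ.comp (cDW.prodMk continuous_snd)
  obtain ⟨M₂, hM₂⟩ := ((isCompact_Icc (a := (0 : ℝ)) (b := T)).prod
    (isCompact_closedBall (0 : EuclideanSpace ℝ (Fin 3)) (R + 1))).exists_bound_of_continuousOn cDW.continuousOn
  set MD : ℝ := max M₂ 0 with hMD
  have hMD0 : 0 ≤ MD := le_max_right _ _
  have hMDW : ∀ s ∈ Icc 0 T, ∀ y ∈ closedBall (0 : EuclideanSpace ℝ (Fin 3)) (R + 1), ‖fderiv ℝ (W s) y‖ ≤ MD :=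
    fun s hs y hy => (hM₂ (s, y) ⟨hs, hy⟩).trans (le_max_left _ _)
  obtain ⟨M₃, hM₃⟩ := ((isCompact_Icc (a := (0 : ℝ)) (b := T)).prod
    (isCompact_closedBall (0 : EuclideanSpace ℝ (Fin 3)) (R + 1))).exists_bound_of_continuousOn cWt.continuousOn
  set MT : ℝ := max M₃ 0 with hMT
  have hMT0 : 0 ≤ MT := le_max_right _ _
  have hMTW : ∀ s ∈ Icc 0 T, ∀ y ∈ closedBall (0 : EuclideanSpace ℝ (Fin 3)) (R + 1), ‖timeDeriv W s y‖ ≤ MT :=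
    fun s hs y hy => (hM₃ (s, y) ⟨hs, hy⟩).trans (le_max_left _ _)
  -- ## classes of the data on the cylinder
  have hUlmem : MemLp (fun z : ℝ × EuclideanSpace ℝ (Fin 3) => Ul z.1 z.2) 2 μQ := by
    refine ⟨hUlm.restrict, ?_⟩
    rw [FunctionSpaces.AubinLions.eLpNorm_two_eq_rpow]
    exact ENNReal.rpow_lt_top_of_nonneg (by norm_num) (((lintegral_mono_set hSQ).trans_lt (hUlfin n)).ne)
  have hUl1 : Integrable (fun z : ℝ × EuclideanSpace ℝ (Fin 3) => Ul z.1 z.2) μQ := hUlmem.integrable one_le_two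
  have hGum : AEStronglyMeasurable (fun z : ℝ × EuclideanSpace ℝ (Fin 3) => Gu z.1 z.2) (volume : Measure (ℝ × EuclideanSpace ℝ (Fin 3))) := by
    have h1 := hGu.locallyIntegrableOn_grad.aestronglyMeasurable
    rwa [Opens.coe_top, Measure.restrict_univ] at h1
  have hGu2 : ∫⁻ z, ‖Gu z.1 z.2‖ₑ ^ 2 ∂μQ < ∞ := by
    have h := NSCylinder.lintegral_enorm_sq_le_of_frobenius (G := Gu) (μ := μQ) (Cg := ∫⁻ z in S,
      ENNReal.ofReal (frobeniusNormSq (Gu z.1 z.2))) le_rfl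
    exact h.trans_lt ((lintegral_mono_set hSslab).trans_lt (hGub n))
  have hGumem : MemLp (fun z : ℝ × EuclideanSpace ℝ (Fin 3) => Gu z.1 z.2) 2 μQ := by
    refine ⟨hGum.restrict, ?_⟩
    rw [FunctionSpaces.AubinLions.eLpNorm_two_eq_rpow]
    exact ENNReal.rpow_lt_top_of_nonneg (by norm_num) hGu2.ne
  have hGu1 : Integrable (fun z : ℝ × EuclideanSpace ℝ (Fin 3) => Gu z.1 z.2) μQ := hGumem.integrable one_le_two
  -- slices of `Ul`, the mollified drift is bounded
  have hUls : ∀ᵐ s : ℝ, AEStronglyMeasurable (Ul s) (volume : Measure (EuclideanSpace ℝ (Fin 3))) := by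
    have h := FunctionSpaces.AubinLions.ae_aestronglyMeasurable_slice (I := univ) (O := univ) (f := uncurry Ul)
      (by rw [univ_prod_univ, Measure.restrict_univ]; exact hUlm)
    simp only [Measure.restrict_univ] at h
    filter_upwards [h] with s hs
    exact hs
  set Kη : ℝ := (eLpNorm (BradshawTsai2019.scaledMollifier η ε) 2 (volume : Measure (EuclideanSpace ℝ (Fin 3))) *
    (CE : ℝ≥0∞) ^ (1 / 2 : ℝ)).toReal with hKη
  have hKη0 : 0 ≤ Kη := ENNReal.toReal_nonneg
  have hmlbd : ∀ᵐ z ∂μQ, ‖mollify η ε Ul z.1 z.2‖ ≤ Kη := by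
    have hs : ∀ᵐ s : ℝ, ∀ y, ‖mollify η ε Ul s y‖ ≤ Kη := by
      filter_upwards [hUls, hUlE] with s hs hE y
      exact norm_mollify_le_of_energy hη hε hs hE y
    have h := (Measure.quasiMeasurePreserving_fst (μ := (volume : Measure ℝ))
      (ν := (volume : Measure (EuclideanSpace ℝ (Fin 3))))).ae hs
    rw [← Measure.volume_eq_prod] at h
    exact ae_restrict_of_ae (h.mono fun z hz => hz z.2)
  have hmlm : AEStronglyMeasurable (fun z : ℝ × EuclideanSpace ℝ (Fin 3) => mollify η ε Ul z.1 z.2) μQ :=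
    (hη.aestronglyMeasurable_mollify ε hUlm).restrict
  -- the lower-order field `F` and its a.e. bound on the cylinder
  set Φ : ℝ × EuclideanSpace ℝ (Fin 3) → ℝ := fun z => (1 + MD) * ‖Ul z.1 z.2‖ + ((R + 1) + M + Kη) * ‖Gu z.1 z.2‖ + MD * M with hΦ
  have hΦi : Integrable Φ μQ := ((hUl1.norm.const_mul _).add (hGu1.norm.const_mul _)).add (integrable_const _)
  have hFbd : ∀ᵐ z ∂μQ, ‖Ul z.1 z.2 + Gu z.1 z.2 z.2 - Gu z.1 z.2 (W z.1 z.2 + mollify η ε Ul z.1 z.2) -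
      fderiv ℝ (W z.1) z.2 (Ul z.1 z.2) - fderiv ℝ (W z.1) z.2 (W z.1 z.2)‖ ≤ Φ z := by
    filter_upwards [ae_restrict_mem hSm, hmlbd] with z hz hmz
    have hs : z.1 ∈ Icc 0 T := Ioo_subset_Icc_self hz.1
    have hy : z.2 ∈ closedBall (0 : EuclideanSpace ℝ (Fin 3)) (R + 1) := ball_subset_closedBall hz.2
    have hyR : ‖z.2‖ ≤ R + 1 := (mem_ball_zero_iff.1 hz.2).le
    have e1 : ‖Gu z.1 z.2 z.2‖ ≤ ‖Gu z.1 z.2‖ * (R + 1) := (le_opNorm _ _).trans (mul_le_mul_of_nonneg_left hyR (norm_nonneg _))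
    have e2 : ‖Gu z.1 z.2 (W z.1 z.2 + mollify η ε Ul z.1 z.2)‖ ≤ ‖Gu z.1 z.2‖ * (M + Kη) :=
      (le_opNorm _ _).trans (mul_le_mul_of_nonneg_left ((norm_add_le _ _).trans (add_le_add (hMW z.1 hs z.2 hy) hmz))
        (norm_nonneg _))
    have e3 : ‖fderiv ℝ (W z.1) z.2 (Ul z.1 z.2)‖ ≤ MD * ‖Ul z.1 z.2‖ :=
      (le_opNorm _ _).trans (mul_le_mul_of_nonneg_right (hMDW z.1 hs z.2 hy) (norm_nonneg _))
    have e4 : ‖fderiv ℝ (W z.1) z.2 (W z.1 z.2)‖ ≤ MD * M :=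
      (le_opNorm _ _).trans (mul_le_mul (hMDW z.1 hs z.2 hy) (hMW z.1 hs z.2 hy) (norm_nonneg _) hMD0)
    calc ‖Ul z.1 z.2 + Gu z.1 z.2 z.2 - Gu z.1 z.2 (W z.1 z.2 + mollify η ε Ul z.1 z.2) -
          fderiv ℝ (W z.1) z.2 (Ul z.1 z.2) - fderiv ℝ (W z.1) z.2 (W z.1 z.2)‖
        ≤ ‖Ul z.1 z.2‖ + ‖Gu z.1 z.2 z.2‖ + ‖Gu z.1 z.2 (W z.1 z.2 + mollify η ε Ul z.1 z.2)‖ +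
          ‖fderiv ℝ (W z.1) z.2 (Ul z.1 z.2)‖ + ‖fderiv ℝ (W z.1) z.2 (W z.1 z.2)‖ := by
          refine (norm_sub_le _ _).trans (add_le_add ((norm_sub_le _ _).trans (add_le_add
            ((norm_sub_le _ _).trans (add_le_add (norm_add_le _ _) le_rfl)) le_rfl)) le_rfl)
      _ ≤ ‖Ul z.1 z.2‖ + ‖Gu z.1 z.2‖ * (R + 1) + ‖Gu z.1 z.2‖ * (M + Kη) + MD * ‖Ul z.1 z.2‖ + MD * M := by
          linarith
      _ = Φ z := by rw [hΦ]; ring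
  have hFm : AEStronglyMeasurable (fun z : ℝ × EuclideanSpace ℝ (Fin 3) => Ul z.1 z.2 + Gu z.1 z.2 z.2 -
      Gu z.1 z.2 (W z.1 z.2 + mollify η ε Ul z.1 z.2) - fderiv ℝ (W z.1) z.2 (Ul z.1 z.2) -
      fderiv ℝ (W z.1) z.2 (W z.1 z.2)) μQ := by
    have m1 : AEStronglyMeasurable (fun z : ℝ × EuclideanSpace ℝ (Fin 3) => Gu z.1 z.2 z.2) μQ :=
      (happ.comp_aestronglyMeasurable (hGum.prodMk continuous_snd.aestronglyMeasurable)).restrict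
    have m2 : AEStronglyMeasurable (fun z : ℝ × EuclideanSpace ℝ (Fin 3) => Gu z.1 z.2 (W z.1 z.2 + mollify η ε Ul z.1 z.2)) μQ :=
      happ.comp_aestronglyMeasurable (hGum.restrict.prodMk (cW.aestronglyMeasurable.restrict.add hmlm))
    have m3 : AEStronglyMeasurable (fun z : ℝ × EuclideanSpace ℝ (Fin 3) => fderiv ℝ (W z.1) z.2 (Ul z.1 z.2)) μQ :=
      happ.comp_aestronglyMeasurable (cDW.aestronglyMeasurable.restrict.prodMk hUlm.restrict)
    have m4 : AEStronglyMeasurable (fun z : ℝ × EuclideanSpace ℝ (Fin 3) => fderiv ℝ (W z.1) z.2 (W z.1 z.2)) μQ :=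
      (happ.comp (cDW.prodMk cW)).aestronglyMeasurable.restrict
    exact (((hUlm.restrict.add m1).sub m2).sub m3).sub m4
  -- ## test fields supported in `‖y‖ < R` vanish with their derivatives off `B(0, R + 1)`
  have hvan : ∀ φ : ℝ → EuclideanSpace ℝ (Fin 3) → EuclideanSpace ℝ (Fin 3), (∀ s y, R ≤ ‖y‖ → φ s y = 0) →
      ∀ s y, y ∉ B → φ s y = 0 ∧ fderiv ℝ (φ s) y = 0 ∧ timeDeriv φ s y = 0 := by
    intro φ hφR s y hy
    have hy' : R < ‖y‖ := by
      rw [hB, mem_ball_zero_iff, not_lt] at hy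
      linarith
    have ho : IsOpen {w : EuclideanSpace ℝ (Fin 3) | R < ‖w‖} := isOpen_lt continuous_const continuous_norm
    have hz : (φ s) =ᶠ[𝓝 y] fun _ => (0 : EuclideanSpace ℝ (Fin 3)) := by
      filter_upwards [ho.mem_nhds hy'] with w hw
      exact hφR s w (le_of_lt hw)
    refine ⟨hφR s y hy'.le, ?_, ?_⟩
    · rw [hz.fderiv_eq, fderiv_fun_const, Pi.zero_apply]
    · have h0 : (fun t => φ t y) = fun _ => (0 : EuclideanSpace ℝ (Fin 3)) := funext fun t => hφR t y hy'.le
      simp only [timeDeriv, h0, deriv_const]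
  -- ## the integrand of `Λ` for a test field: measurability, domination, integrability, Fubini
  have key : ∀ φ : ℝ → EuclideanSpace ℝ (Fin 3) → EuclideanSpace ℝ (Fin 3), IsPeriodicDivFreeTest T φ → (∀ s y, R ≤ ‖y‖ → φ s y = 0) →
      ∃ Nφ : ℝ, 0 ≤ Nφ ∧
      (∀ z : ℝ × EuclideanSpace ℝ (Fin 3), ‖φ z.1 z.2‖ ≤ Nφ ∧ ‖fderiv ℝ (φ z.1) z.2‖ ≤ Nφ ∧ ‖timeDeriv φ z.1 z.2‖ ≤ Nφ) ∧
      Integrable (fun z : ℝ × EuclideanSpace ℝ (Fin 3) => (⟪Ul z.1 z.2, timeDeriv φ z.1 z.2⟫ - frobeniusInner (Gu z.1 z.2) (fderiv ℝ (φ z.1) z.2) +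
        ⟪Ul z.1 z.2 + Gu z.1 z.2 z.2 - Gu z.1 z.2 (W z.1 z.2 + mollify η ε Ul z.1 z.2) -
          fderiv ℝ (W z.1) z.2 (Ul z.1 z.2) - fderiv ℝ (W z.1) z.2 (W z.1 z.2), φ z.1 z.2⟫)) μQ ∧
      Integrable (fun s => ∫ y, (⟪Ul s y, timeDeriv φ s y⟫ - frobeniusInner (Gu s y) (fderiv ℝ (φ s) y) +
        ⟪Ul s y + Gu s y y - Gu s y (W s y + mollify η ε Ul s y) -
          fderiv ℝ (W s) y (Ul s y) - fderiv ℝ (W s) y (W s y), φ s y⟫)) ((volume : Measure ℝ).restrict I) ∧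
      (∫ s in I, ∫ y, (⟪Ul s y, timeDeriv φ s y⟫ - frobeniusInner (Gu s y) (fderiv ℝ (φ s) y) +
        ⟪Ul s y + Gu s y y - Gu s y (W s y + mollify η ε Ul s y) -
          fderiv ℝ (W s) y (Ul s y) - fderiv ℝ (W s) y (W s y), φ s y⟫)) = (∫ z, (⟪Ul z.1 z.2, timeDeriv φ z.1 z.2⟫ - frobeniusInner (Gu z.1 z.2) (fderiv ℝ (φ z.1) z.2) +
        ⟪Ul z.1 z.2 + Gu z.1 z.2 z.2 - Gu z.1 z.2 (W z.1 z.2 + mollify η ε Ul z.1 z.2) -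
          fderiv ℝ (W z.1) z.2 (Ul z.1 z.2) - fderiv ℝ (W z.1) z.2 (W z.1 z.2), φ z.1 z.2⟫) ∂μQ) ∧
      IntegrableOn (fun s => lerayPairing W s (φ s)) I (volume : Measure ℝ) := by
    intro φ hφ hφR
    have hφ1 : ContDiff ℝ 1 (uncurry φ) := hφ.contDiff.of_le (by exact_mod_cast le_top)
    have cφ : Continuous fun z : ℝ × EuclideanSpace ℝ (Fin 3) => φ z.1 z.2 := hφ1.continuous
    have cφt : Continuous fun z : ℝ × EuclideanSpace ℝ (Fin 3) => timeDeriv φ z.1 z.2 := continuous_timeDeriv_of_contDiff_one hφ1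
    have cDφ : Continuous fun z : ℝ × EuclideanSpace ℝ (Fin 3) => fderiv ℝ (φ z.1) z.2 := continuous_fderiv_slice_of_contDiff hφ1
    have hφB := hvan φ hφR
    -- periodicity of the derivative fields and global bounds
    have hφtper : ∀ s y, timeDeriv φ (s + T) y = timeDeriv φ s y := by
      intro s y
      have h := deriv_comp_add_const (f := fun τ => φ τ y) (a := T) (x := s)
      simp only [hφ.periodic] at h
      rw [timeDeriv, timeDeriv]
      exact h.symm
    have hDφper : ∀ s y, fderiv ℝ (φ (s + T)) y = fderiv ℝ (φ s) y := by
      intro s y; rw [show φ (s + T) = φ s from funext (hφ.periodic s)]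
    obtain ⟨C0, hC00, hC0⟩ := exists_global_bound_of_periodic cφ hT (fun s y => hφ.periodic s y)
      (fun z hz => (hφB z.1 z.2 hz).1)
    obtain ⟨C1, hC10, hC1⟩ := exists_global_bound_of_periodic cDφ hT hDφper (fun z hz => (hφB z.1 z.2 hz).2.1)
    obtain ⟨C2, hC20, hC2⟩ := exists_global_bound_of_periodic cφt hT hφtper (fun z hz => (hφB z.1 z.2 hz).2.2)
    set N : ℝ := C0 + C1 + C2 with hN
    have hN0 : 0 ≤ N := by positivity
    have bN : ∀ z : ℝ × EuclideanSpace ℝ (Fin 3), ‖φ z.1 z.2‖ ≤ N ∧ ‖fderiv ℝ (φ z.1) z.2‖ ≤ N ∧ ‖timeDeriv φ z.1 z.2‖ ≤ N := fun z =>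
      ⟨(hC0 z).trans (by linarith), (hC1 z).trans (by linarith), (hC2 z).trans (by linarith)⟩
    -- measurability and domination of the integrand
    have hOm : AEStronglyMeasurable (fun z : ℝ × EuclideanSpace ℝ (Fin 3) => (⟪Ul z.1 z.2, timeDeriv φ z.1 z.2⟫ - frobeniusInner (Gu z.1 z.2) (fderiv ℝ (φ z.1) z.2) +
        ⟪Ul z.1 z.2 + Gu z.1 z.2 z.2 - Gu z.1 z.2 (W z.1 z.2 + mollify η ε Ul z.1 z.2) -
          fderiv ℝ (W z.1) z.2 (Ul z.1 z.2) - fderiv ℝ (W z.1) z.2 (W z.1 z.2), φ z.1 z.2⟫)) μQ := by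
      have hUlm' : AEStronglyMeasurable (fun z : ℝ × EuclideanSpace ℝ (Fin 3) => Ul z.1 z.2) μQ := hUlm.restrict
      have mA : AEStronglyMeasurable (fun z : ℝ × EuclideanSpace ℝ (Fin 3) => ⟪Ul z.1 z.2, timeDeriv φ z.1 z.2⟫) μQ :=
        hUlm'.inner (𝕜 := ℝ) cφt.aestronglyMeasurable.restrict
      have mB0 : AEStronglyMeasurable (fun z : ℝ × EuclideanSpace ℝ (Fin 3) =>
          ∑ i, ⟪Gu z.1 z.2 (stdOrthonormalBasis ℝ (EuclideanSpace ℝ (Fin 3)) i),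
            fderiv ℝ (φ z.1) z.2 (stdOrthonormalBasis ℝ (EuclideanSpace ℝ (Fin 3)) i)⟫) μQ := by
        have h := Finset.aestronglyMeasurable_sum (Finset.univ) fun i (_ : i ∈ Finset.univ) =>
          ((happ.comp_aestronglyMeasurable (hGum.restrict.prodMk
            (aestronglyMeasurable_const (b := stdOrthonormalBasis ℝ (EuclideanSpace ℝ (Fin 3)) i)))).inner (𝕜 := ℝ)
            (happ.comp_aestronglyMeasurable (cDφ.aestronglyMeasurable.restrict.prodMk
              (aestronglyMeasurable_const (b := stdOrthonormalBasis ℝ (EuclideanSpace ℝ (Fin 3)) i)))) :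
            AEStronglyMeasurable (fun z : ℝ × EuclideanSpace ℝ (Fin 3) =>
              ⟪Gu z.1 z.2 (stdOrthonormalBasis ℝ (EuclideanSpace ℝ (Fin 3)) i),
                fderiv ℝ (φ z.1) z.2 (stdOrthonormalBasis ℝ (EuclideanSpace ℝ (Fin 3)) i)⟫) μQ)
        rw [Finset.sum_fn] at h
        exact h
      have mB : AEStronglyMeasurable (fun z : ℝ × EuclideanSpace ℝ (Fin 3) =>
          frobeniusInner (Gu z.1 z.2) (fderiv ℝ (φ z.1) z.2)) μQ := by
        simp only [frobeniusInner]
        exact mB0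
      have mC : AEStronglyMeasurable (fun z : ℝ × EuclideanSpace ℝ (Fin 3) =>
          ⟪Ul z.1 z.2 + Gu z.1 z.2 z.2 - Gu z.1 z.2 (W z.1 z.2 + mollify η ε Ul z.1 z.2) -
            fderiv ℝ (W z.1) z.2 (Ul z.1 z.2) - fderiv ℝ (W z.1) z.2 (W z.1 z.2), φ z.1 z.2⟫) μQ :=
        hFm.inner (𝕜 := ℝ) cφ.aestronglyMeasurable.restrict
      exact (mA.sub mB).add mC
    have hOdom : ∀ᵐ z ∂μQ, ‖(⟪Ul z.1 z.2, timeDeriv φ z.1 z.2⟫ - frobeniusInner (Gu z.1 z.2) (fderiv ℝ (φ z.1) z.2) +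
        ⟪Ul z.1 z.2 + Gu z.1 z.2 z.2 - Gu z.1 z.2 (W z.1 z.2 + mollify η ε Ul z.1 z.2) -
          fderiv ℝ (W z.1) z.2 (Ul z.1 z.2) - fderiv ℝ (W z.1) z.2 (W z.1 z.2), φ z.1 z.2⟫)‖ ≤ N * (‖Ul z.1 z.2‖ + 3 * ‖Gu z.1 z.2‖ + Φ z) := by
      filter_upwards [hFbd] with z hz
      have t1 : |⟪Ul z.1 z.2, timeDeriv φ z.1 z.2⟫| ≤ ‖Ul z.1 z.2‖ * N :=
        (abs_real_inner_le_norm _ _).trans (mul_le_mul_of_nonneg_left (bN z).2.2 (norm_nonneg _))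
      have t2 : |frobeniusInner (Gu z.1 z.2) (fderiv ℝ (φ z.1) z.2)| ≤ 3 * ‖Gu z.1 z.2‖ * N :=
        (abs_frobeniusInner_le _ _).trans (mul_le_mul_of_nonneg_left (bN z).2.1 (by positivity))
      have t3 : |⟪(Ul z.1 z.2 + Gu z.1 z.2 z.2 - Gu z.1 z.2 (W z.1 z.2 + mollify η ε Ul z.1 z.2) - fderiv ℝ (W z.1) z.2 (Ul z.1 z.2) - fderiv ℝ (W z.1) z.2 (W z.1 z.2)), φ z.1 z.2⟫| ≤ Φ z * N :=
        (abs_real_inner_le_norm _ _).trans (mul_le_mul hz (bN z).1 (norm_nonneg _) ((norm_nonneg _).trans hz))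
      rw [Real.norm_eq_abs]
      have := abs_add_le (⟪Ul z.1 z.2, timeDeriv φ z.1 z.2⟫ - frobeniusInner (Gu z.1 z.2) (fderiv ℝ (φ z.1) z.2))
        ⟪(Ul z.1 z.2 + Gu z.1 z.2 z.2 - Gu z.1 z.2 (W z.1 z.2 + mollify η ε Ul z.1 z.2) - fderiv ℝ (W z.1) z.2 (Ul z.1 z.2) - fderiv ℝ (W z.1) z.2 (W z.1 z.2)), φ z.1 z.2⟫
      have := abs_sub (⟪Ul z.1 z.2, timeDeriv φ z.1 z.2⟫) (frobeniusInner (Gu z.1 z.2) (fderiv ℝ (φ z.1) z.2))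
      have e : N * (‖Ul z.1 z.2‖ + 3 * ‖Gu z.1 z.2‖ + Φ z) = ‖Ul z.1 z.2‖ * N + 3 * ‖Gu z.1 z.2‖ * N + Φ z * N := by ring
      rw [e]
      linarith
    have hOi : Integrable (fun z : ℝ × EuclideanSpace ℝ (Fin 3) => (⟪Ul z.1 z.2, timeDeriv φ z.1 z.2⟫ - frobeniusInner (Gu z.1 z.2) (fderiv ℝ (φ z.1) z.2) +
        ⟪Ul z.1 z.2 + Gu z.1 z.2 z.2 - Gu z.1 z.2 (W z.1 z.2 + mollify η ε Ul z.1 z.2) -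
          fderiv ℝ (W z.1) z.2 (Ul z.1 z.2) - fderiv ℝ (W z.1) z.2 (W z.1 z.2), φ z.1 z.2⟫)) μQ :=
by
      have hbdi : Integrable (fun z : ℝ × EuclideanSpace ℝ (Fin 3) => N * (‖Ul z.1 z.2‖ + 3 * ‖Gu z.1 z.2‖ + Φ z)) μQ :=
        ((hUl1.norm.add (hGu1.norm.const_mul 3)).add hΦi).const_mul N
      exact Integrable.mono' hbdi hOm hOdom
    -- Fubini
    have hprodI : (volume.restrict (I ×ˢ (univ : Set (EuclideanSpace ℝ (Fin 3)))) : Measure (ℝ × EuclideanSpace ℝ (Fin 3))) =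
        ((volume : Measure ℝ).restrict I).prod (volume : Measure (EuclideanSpace ℝ (Fin 3))) := by
      rw [FunctionSpaces.AubinLions.volume_restrict_prod, Measure.restrict_univ]
    have hSsub : S ⊆ I ×ˢ (univ : Set (EuclideanSpace ℝ (Fin 3))) := prod_mono Subset.rfl (subset_univ _)
    have hIum : MeasurableSet (I ×ˢ (univ : Set (EuclideanSpace ℝ (Fin 3)))) := measurableSet_Ioo.prod MeasurableSet.univ
    have hOz : ∀ z : ℝ × EuclideanSpace ℝ (Fin 3), z.2 ∉ B → (⟪Ul z.1 z.2, timeDeriv φ z.1 z.2⟫ - frobeniusInner (Gu z.1 z.2) (fderiv ℝ (φ z.1) z.2) +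
        ⟪Ul z.1 z.2 + Gu z.1 z.2 z.2 - Gu z.1 z.2 (W z.1 z.2 + mollify η ε Ul z.1 z.2) -
          fderiv ℝ (W z.1) z.2 (Ul z.1 z.2) - fderiv ℝ (W z.1) z.2 (W z.1 z.2), φ z.1 z.2⟫) = 0 := by
      intro z hz
      obtain ⟨h1, h2, h3⟩ := hφB z.1 z.2 hz
      rw [h1, h2, h3, inner_zero_right, inner_zero_right, frobeniusInner_zero_right]
      ring
    have h1 : IntegrableOn (fun z : ℝ × EuclideanSpace ℝ (Fin 3) => (⟪Ul z.1 z.2, timeDeriv φ z.1 z.2⟫ - frobeniusInner (Gu z.1 z.2) (fderiv ℝ (φ z.1) z.2) +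
        ⟪Ul z.1 z.2 + Gu z.1 z.2 z.2 - Gu z.1 z.2 (W z.1 z.2 + mollify η ε Ul z.1 z.2) -
          fderiv ℝ (W z.1) z.2 (Ul z.1 z.2) - fderiv ℝ (W z.1) z.2 (W z.1 z.2), φ z.1 z.2⟫)) (I ×ˢ (univ : Set (EuclideanSpace ℝ (Fin 3)))) volume :=
      IntegrableOn.of_forall_sdiff_eq_zero hOi hIum fun z hz => hOz z fun h => hz.2 ⟨hz.1.1, h⟩
    have h2 : Integrable (uncurry fun s y => (⟪Ul s y, timeDeriv φ s y⟫ - frobeniusInner (Gu s y) (fderiv ℝ (φ s) y) +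
        ⟪Ul s y + Gu s y y - Gu s y (W s y + mollify η ε Ul s y) -
          fderiv ℝ (W s) y (Ul s y) - fderiv ℝ (W s) y (W s y), φ s y⟫))
        (((volume : Measure ℝ).restrict I).prod (volume : Measure (EuclideanSpace ℝ (Fin 3)))) := by
      rw [← hprodI]; exact h1
    have hfub : (∫ s in I, ∫ y, (⟪Ul s y, timeDeriv φ s y⟫ - frobeniusInner (Gu s y) (fderiv ℝ (φ s) y) +
        ⟪Ul s y + Gu s y y - Gu s y (W s y + mollify η ε Ul s y) -
          fderiv ℝ (W s) y (Ul s y) - fderiv ℝ (W s) y (W s y), φ s y⟫)) = ∫ z, (⟪Ul z.1 z.2, timeDeriv φ z.1 z.2⟫ - frobeniusInner (Gu z.1 z.2) (fderiv ℝ (φ z.1) z.2) +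
        ⟪Ul z.1 z.2 + Gu z.1 z.2 z.2 - Gu z.1 z.2 (W z.1 z.2 + mollify η ε Ul z.1 z.2) -
          fderiv ℝ (W z.1) z.2 (Ul z.1 z.2) - fderiv ℝ (W z.1) z.2 (W z.1 z.2), φ z.1 z.2⟫) ∂μQ := by
      rw [integral_integral h2, ← hprodI]
      exact setIntegral_eq_of_subset_of_forall_sdiff_eq_zero hIum hSsub fun z hz => hOz z fun h => hz.2 ⟨hz.1.1, h⟩
    -- the profile pairing on `(0, T)`
    have cfrob : Continuous fun z : ℝ × EuclideanSpace ℝ (Fin 3) => frobeniusInner (fderiv ℝ (W z.1) z.2) (fderiv ℝ (φ z.1) z.2) :=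
      continuous_frobeniusInner_uncurry.comp (cDW.prodMk cDφ)
    have hLp : IntegrableOn (fun s => lerayPairing W s (φ s)) I (volume : Measure ℝ) := by
      have c₁ : Continuous fun z : ℝ × EuclideanSpace ℝ (Fin 3) =>
          ⟪timeDeriv W z.1 z.2 - W z.1 z.2 - fderiv ℝ (W z.1) z.2 z.2, φ z.1 z.2⟫ +
            frobeniusInner (fderiv ℝ (W z.1) z.2) (fderiv ℝ (φ z.1) z.2) := (((cWt.sub cW).sub cDWy).inner cφ).add cfrob
      have hz₁ : ∀ z : ℝ × EuclideanSpace ℝ (Fin 3), z.2 ∉ B →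
          ⟪timeDeriv W z.1 z.2 - W z.1 z.2 - fderiv ℝ (W z.1) z.2 z.2, φ z.1 z.2⟫ +
            frobeniusInner (fderiv ℝ (W z.1) z.2) (fderiv ℝ (φ z.1) z.2) = 0 := by
        intro z hz
        obtain ⟨h1, h2, -⟩ := hφB z.1 z.2 hz
        rw [h1, h2, inner_zero_right, frobeniusInner_zero_right, add_zero]
      exact integrableOn_integral_slice c₁ hz₁ 0 T
    exact ⟨N, hN0, bN, hOi, h2.integral_prod_left, hfub, hLp⟩
  -- ## the estimate for one approximant
  have hest : ∀ δ : ℝ, 0 < δ → |∫ s in I, ((∫ y, (⟪Ul s y, timeDeriv f s y⟫ - frobeniusInner (Gu s y) (fderiv ℝ (f s) y) +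
        ⟪Ul s y + Gu s y y - Gu s y (W s y + mollify η ε Ul s y) -
          fderiv ℝ (W s) y (Ul s y) - fderiv ℝ (W s) y (W s y), f s y⟫)) - lerayPairing W s (f s))| ≤
      ((∫ z, (‖Ul z.1 z.2‖ + 3 * ‖Gu z.1 z.2‖ + Φ z) ∂μQ) +
        T * ((MT + M + MD * (R + 1) + 3 * MD) * (volume B).toReal)) * δ := by
    intro δ hδ
    obtain ⟨g, hg, hgR, hfg, hΛg⟩ := happrox δ hδ
    obtain ⟨Nf, hNf0, bNf, hOf, hcf, hfubf, hLf⟩ := key f hf hfR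
    obtain ⟨Ng, hNg0, bNg, hOg, hcg, hfubg, hLg⟩ := key g hg hgR
    -- `Λ f = Λ f − Λ g = ∫ (O_f − O_g) − ∫_I (ℓ_f − ℓ_g)`
    have eΛf : (∫ s in I, ((∫ y, (⟪Ul s y, timeDeriv f s y⟫ - frobeniusInner (Gu s y) (fderiv ℝ (f s) y) +
        ⟪Ul s y + Gu s y y - Gu s y (W s y + mollify η ε Ul s y) -
          fderiv ℝ (W s) y (Ul s y) - fderiv ℝ (W s) y (W s y), f s y⟫)) - lerayPairing W s (f s))) =
        (∫ z, (⟪Ul z.1 z.2, timeDeriv f z.1 z.2⟫ - frobeniusInner (Gu z.1 z.2) (fderiv ℝ (f z.1) z.2) +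
        ⟪Ul z.1 z.2 + Gu z.1 z.2 z.2 - Gu z.1 z.2 (W z.1 z.2 + mollify η ε Ul z.1 z.2) -
          fderiv ℝ (W z.1) z.2 (Ul z.1 z.2) - fderiv ℝ (W z.1) z.2 (W z.1 z.2), f z.1 z.2⟫) ∂μQ) - ∫ s in I, lerayPairing W s (f s) := by
      rw [integral_sub hcf hLf, hfubf]
    have eΛg : (∫ s in I, ((∫ y, (⟪Ul s y, timeDeriv g s y⟫ - frobeniusInner (Gu s y) (fderiv ℝ (g s) y) +
        ⟪Ul s y + Gu s y y - Gu s y (W s y + mollify η ε Ul s y) -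
          fderiv ℝ (W s) y (Ul s y) - fderiv ℝ (W s) y (W s y), g s y⟫)) - lerayPairing W s (g s))) =
        (∫ z, (⟪Ul z.1 z.2, timeDeriv g z.1 z.2⟫ - frobeniusInner (Gu z.1 z.2) (fderiv ℝ (g z.1) z.2) +
        ⟪Ul z.1 z.2 + Gu z.1 z.2 z.2 - Gu z.1 z.2 (W z.1 z.2 + mollify η ε Ul z.1 z.2) -
          fderiv ℝ (W z.1) z.2 (Ul z.1 z.2) - fderiv ℝ (W z.1) z.2 (W z.1 z.2), g z.1 z.2⟫) ∂μQ) - ∫ s in I, lerayPairing W s (g s) := by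
      rw [integral_sub hcg hLg, hfubg]
    have hΛg' : (∫ z, (⟪Ul z.1 z.2, timeDeriv g z.1 z.2⟫ - frobeniusInner (Gu z.1 z.2) (fderiv ℝ (g z.1) z.2) +
        ⟪Ul z.1 z.2 + Gu z.1 z.2 z.2 - Gu z.1 z.2 (W z.1 z.2 + mollify η ε Ul z.1 z.2) -
          fderiv ℝ (W z.1) z.2 (Ul z.1 z.2) - fderiv ℝ (W z.1) z.2 (W z.1 z.2), g z.1 z.2⟫) ∂μQ) - ∫ s in I, lerayPairing W s (g s) = 0 := by
      rw [← eΛg]; exact hΛg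
    -- the bulk term
    have hbulk : |(∫ z, (⟪Ul z.1 z.2, timeDeriv f z.1 z.2⟫ - frobeniusInner (Gu z.1 z.2) (fderiv ℝ (f z.1) z.2) +
        ⟪Ul z.1 z.2 + Gu z.1 z.2 z.2 - Gu z.1 z.2 (W z.1 z.2 + mollify η ε Ul z.1 z.2) -
          fderiv ℝ (W z.1) z.2 (Ul z.1 z.2) - fderiv ℝ (W z.1) z.2 (W z.1 z.2), f z.1 z.2⟫) ∂μQ) - ∫ z, (⟪Ul z.1 z.2, timeDeriv g z.1 z.2⟫ - frobeniusInner (Gu z.1 z.2) (fderiv ℝ (g z.1) z.2) +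
        ⟪Ul z.1 z.2 + Gu z.1 z.2 z.2 - Gu z.1 z.2 (W z.1 z.2 + mollify η ε Ul z.1 z.2) -
          fderiv ℝ (W z.1) z.2 (Ul z.1 z.2) - fderiv ℝ (W z.1) z.2 (W z.1 z.2), g z.1 z.2⟫) ∂μQ| ≤
        (∫ z, (‖Ul z.1 z.2‖ + 3 * ‖Gu z.1 z.2‖ + Φ z) ∂μQ) * δ := by
      rw [← integral_sub hOf hOg, ← integral_mul_const]
      have hbdi : Integrable (fun z : ℝ × EuclideanSpace ℝ (Fin 3) => (‖Ul z.1 z.2‖ + 3 * ‖Gu z.1 z.2‖ + Φ z) * δ) μQ :=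
        ((hUl1.norm.add (hGu1.norm.const_mul 3)).add hΦi).mul_const δ
      refine (abs_integral_le_integral_abs).trans (integral_mono_ae (hOf.sub hOg).abs hbdi ?_)
      filter_upwards [hFbd] with z hz
      have hd : (⟪Ul z.1 z.2, timeDeriv f z.1 z.2⟫ - frobeniusInner (Gu z.1 z.2) (fderiv ℝ (f z.1) z.2) +
        ⟪Ul z.1 z.2 + Gu z.1 z.2 z.2 - Gu z.1 z.2 (W z.1 z.2 + mollify η ε Ul z.1 z.2) -
          fderiv ℝ (W z.1) z.2 (Ul z.1 z.2) - fderiv ℝ (W z.1) z.2 (W z.1 z.2), f z.1 z.2⟫) - (⟪Ul z.1 z.2, timeDeriv g z.1 z.2⟫ - frobeniusInner (Gu z.1 z.2) (fderiv ℝ (g z.1) z.2) +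
        ⟪Ul z.1 z.2 + Gu z.1 z.2 z.2 - Gu z.1 z.2 (W z.1 z.2 + mollify η ε Ul z.1 z.2) -
          fderiv ℝ (W z.1) z.2 (Ul z.1 z.2) - fderiv ℝ (W z.1) z.2 (W z.1 z.2), g z.1 z.2⟫) =
          ⟪Ul z.1 z.2, timeDeriv f z.1 z.2 - timeDeriv g z.1 z.2⟫ -
            frobeniusInner (Gu z.1 z.2) (fderiv ℝ (f z.1) z.2 - fderiv ℝ (g z.1) z.2) +
            ⟪(Ul z.1 z.2 + Gu z.1 z.2 z.2 - Gu z.1 z.2 (W z.1 z.2 + mollify η ε Ul z.1 z.2) - fderiv ℝ (W z.1) z.2 (Ul z.1 z.2) - fderiv ℝ (W z.1) z.2 (W z.1 z.2)), f z.1 z.2 - g z.1 z.2⟫ := by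
        rw [inner_sub_right, inner_sub_right, frobeniusInner_sub_right]; ring
      show |(⟪Ul z.1 z.2, timeDeriv f z.1 z.2⟫ - frobeniusInner (Gu z.1 z.2) (fderiv ℝ (f z.1) z.2) +
        ⟪Ul z.1 z.2 + Gu z.1 z.2 z.2 - Gu z.1 z.2 (W z.1 z.2 + mollify η ε Ul z.1 z.2) -
          fderiv ℝ (W z.1) z.2 (Ul z.1 z.2) - fderiv ℝ (W z.1) z.2 (W z.1 z.2), f z.1 z.2⟫) - (⟪Ul z.1 z.2, timeDeriv g z.1 z.2⟫ - frobeniusInner (Gu z.1 z.2) (fderiv ℝ (g z.1) z.2) +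
        ⟪Ul z.1 z.2 + Gu z.1 z.2 z.2 - Gu z.1 z.2 (W z.1 z.2 + mollify η ε Ul z.1 z.2) -
          fderiv ℝ (W z.1) z.2 (Ul z.1 z.2) - fderiv ℝ (W z.1) z.2 (W z.1 z.2), g z.1 z.2⟫)| ≤ (‖Ul z.1 z.2‖ + 3 * ‖Gu z.1 z.2‖ + Φ z) * δ
      rw [hd]
      obtain ⟨d1, d2, d3⟩ := hfg z.1 z.2
      have t1 : |⟪Ul z.1 z.2, timeDeriv f z.1 z.2 - timeDeriv g z.1 z.2⟫| ≤ ‖Ul z.1 z.2‖ * δ :=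
        (abs_real_inner_le_norm _ _).trans (mul_le_mul_of_nonneg_left d3 (norm_nonneg _))
      have t2 : |frobeniusInner (Gu z.1 z.2) (fderiv ℝ (f z.1) z.2 - fderiv ℝ (g z.1) z.2)| ≤ 3 * ‖Gu z.1 z.2‖ * δ :=
        (abs_frobeniusInner_le _ _).trans (mul_le_mul_of_nonneg_left d2 (by positivity))
      have t3 : |⟪(Ul z.1 z.2 + Gu z.1 z.2 z.2 - Gu z.1 z.2 (W z.1 z.2 + mollify η ε Ul z.1 z.2) - fderiv ℝ (W z.1) z.2 (Ul z.1 z.2) - fderiv ℝ (W z.1) z.2 (W z.1 z.2)), f z.1 z.2 - g z.1 z.2⟫| ≤ Φ z * δ :=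
        (abs_real_inner_le_norm _ _).trans (mul_le_mul hz d1 (norm_nonneg _) ((norm_nonneg _).trans hz))
      have := abs_add_le (⟪Ul z.1 z.2, timeDeriv f z.1 z.2 - timeDeriv g z.1 z.2⟫ -
        frobeniusInner (Gu z.1 z.2) (fderiv ℝ (f z.1) z.2 - fderiv ℝ (g z.1) z.2)) ⟪(Ul z.1 z.2 + Gu z.1 z.2 z.2 - Gu z.1 z.2 (W z.1 z.2 + mollify η ε Ul z.1 z.2) - fderiv ℝ (W z.1) z.2 (Ul z.1 z.2) - fderiv ℝ (W z.1) z.2 (W z.1 z.2)), f z.1 z.2 - g z.1 z.2⟫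
      have := abs_sub (⟪Ul z.1 z.2, timeDeriv f z.1 z.2 - timeDeriv g z.1 z.2⟫)
        (frobeniusInner (Gu z.1 z.2) (fderiv ℝ (f z.1) z.2 - fderiv ℝ (g z.1) z.2))
      have e : (‖Ul z.1 z.2‖ + 3 * ‖Gu z.1 z.2‖ + Φ z) * δ = ‖Ul z.1 z.2‖ * δ + 3 * ‖Gu z.1 z.2‖ * δ + Φ z * δ := by ring
      rw [e]
      linarith
    -- the profile term
    have hprof : |(∫ s in I, lerayPairing W s (f s)) - ∫ s in I, lerayPairing W s (g s)| ≤
        T * ((MT + M + MD * (R + 1) + 3 * MD) * (volume B).toReal) * δ := by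
      rw [← integral_sub hLf hLg]
      have hvolI : (volume I) = ENNReal.ofReal T := by rw [hI, Real.volume_Ioo, sub_zero]
      have hb : ∀ s ∈ I, ‖lerayPairing W s (f s) - lerayPairing W s (g s)‖ ≤
          ((MT + M + MD * (R + 1) + 3 * MD) * (volume B).toReal) * δ := by
        intro s hs
        have hsI : s ∈ Icc 0 T := Ioo_subset_Icc_self hs
        -- both pairings are integrals of continuous compactly supported functions
        have cA : Continuous fun y : EuclideanSpace ℝ (Fin 3) => timeDeriv W s y - W s y - fderiv ℝ (W s) y y :=
          ((cWt.comp (Continuous.prodMk_right s)).sub (cW.comp (Continuous.prodMk_right s))).sub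
            (cDWy.comp (Continuous.prodMk_right s))
        have hint : ∀ {φ : ℝ → EuclideanSpace ℝ (Fin 3) → EuclideanSpace ℝ (Fin 3)}, IsPeriodicDivFreeTest T φ → (∀ s y, R ≤ ‖y‖ → φ s y = 0) →
            Integrable (fun y => ⟪timeDeriv W s y - W s y - fderiv ℝ (W s) y y, φ s y⟫ +
              frobeniusInner (fderiv ℝ (W s) y) (fderiv ℝ (φ s) y)) (volume : Measure (EuclideanSpace ℝ (Fin 3))) := by
          intro φ hφ hφR
          have hφ1 : ContDiff ℝ 1 (uncurry φ) := hφ.contDiff.of_le (by exact_mod_cast le_top)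
          have c : Continuous fun y => ⟪timeDeriv W s y - W s y - fderiv ℝ (W s) y y, φ s y⟫ +
              frobeniusInner (fderiv ℝ (W s) y) (fderiv ℝ (φ s) y) :=
            (cA.inner (hφ1.continuous.comp (Continuous.prodMk_right s))).add
              (continuous_frobeniusInner_uncurry.comp ((cDW.comp (Continuous.prodMk_right s)).prodMk
                ((continuous_fderiv_slice_of_contDiff hφ1).comp (Continuous.prodMk_right s))))
          refine c.integrable_of_hasCompactSupport (HasCompactSupport.intro (isCompact_closedBall (0 : EuclideanSpace ℝ (Fin 3)) (R + 1))
            fun y hy => ?_)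
          have hy' : R < ‖y‖ := by
            rw [mem_closedBall_zero_iff, not_le] at hy; linarith
          have ho : IsOpen {w : EuclideanSpace ℝ (Fin 3) | R < ‖w‖} := isOpen_lt continuous_const continuous_norm
          have hz : (φ s) =ᶠ[𝓝 y] fun _ => (0 : EuclideanSpace ℝ (Fin 3)) := by
            filter_upwards [ho.mem_nhds hy'] with w hw
            exact hφR s w (le_of_lt hw)
          rw [hφR s y hy'.le, hz.fderiv_eq, fderiv_fun_const, Pi.zero_apply, inner_zero_right,
            frobeniusInner_zero_right, add_zero]
        have e : lerayPairing W s (f s) - lerayPairing W s (g s) =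
            ∫ y, (⟪timeDeriv W s y - W s y - fderiv ℝ (W s) y y, f s y - g s y⟫ +
              frobeniusInner (fderiv ℝ (W s) y) (fderiv ℝ (f s) y - fderiv ℝ (g s) y)) := by
          rw [lerayPairing, lerayPairing, ← integral_sub (hint hf hfR) (hint hg hgR)]
          refine integral_congr_ae (ae_of_all _ fun y => ?_)
          dsimp only
          rw [inner_sub_right, frobeniusInner_sub_right]; ring
        rw [e]
        -- the integrand is supported in `B` and bounded by `(MT + M + MD (R+1) + 3 MD) δ`
        have hsupp : ∀ y, y ∉ B → ⟪timeDeriv W s y - W s y - fderiv ℝ (W s) y y, f s y - g s y⟫ +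
            frobeniusInner (fderiv ℝ (W s) y) (fderiv ℝ (f s) y - fderiv ℝ (g s) y) = 0 := by
          intro y hy
          obtain ⟨f1, f2, -⟩ := hvan f hfR s y hy
          obtain ⟨g1, g2, -⟩ := hvan g hgR s y hy
          rw [f1, g1, f2, g2, sub_zero, sub_zero, inner_zero_right, frobeniusInner_zero_right, add_zero]
        rw [← setIntegral_eq_integral_of_forall_compl_eq_zero (s := B) fun y hy => hsupp y hy]
        have hBfin : volume B < ⊤ := measure_ball_lt_top
        have hbd : ∀ y ∈ B, ‖⟪timeDeriv W s y - W s y - fderiv ℝ (W s) y y, f s y - g s y⟫ +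
            frobeniusInner (fderiv ℝ (W s) y) (fderiv ℝ (f s) y - fderiv ℝ (g s) y)‖ ≤
            (MT + M + MD * (R + 1) + 3 * MD) * δ := by
          intro y hy
          have hy' : y ∈ closedBall (0 : EuclideanSpace ℝ (Fin 3)) (R + 1) := ball_subset_closedBall hy
          have hyR : ‖y‖ ≤ R + 1 := (mem_ball_zero_iff.1 hy).le
          obtain ⟨d1, d2, -⟩ := hfg s y
          have hA : ‖timeDeriv W s y - W s y - fderiv ℝ (W s) y y‖ ≤ MT + M + MD * (R + 1) := by
            refine (norm_sub_le _ _).trans (add_le_add ((norm_sub_le _ _).trans (add_le_add (hMTW s hsI y hy')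
              (hMW s hsI y hy'))) ?_)
            exact (le_opNorm _ _).trans (mul_le_mul (hMDW s hsI y hy') hyR (norm_nonneg _) hMD0)
          have t1 : |⟪timeDeriv W s y - W s y - fderiv ℝ (W s) y y, f s y - g s y⟫| ≤ (MT + M + MD * (R + 1)) * δ :=
            (abs_real_inner_le_norm _ _).trans (mul_le_mul hA d1 (norm_nonneg _) (by positivity))
          have t2 : |frobeniusInner (fderiv ℝ (W s) y) (fderiv ℝ (f s) y - fderiv ℝ (g s) y)| ≤ 3 * MD * δ :=
            (abs_frobeniusInner_le _ _).trans (mul_le_mul (mul_le_mul_of_nonneg_left (hMDW s hsI y hy') (by norm_num))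
              d2 (norm_nonneg _) (by positivity))
          rw [Real.norm_eq_abs]
          refine (abs_add_le _ _).trans ?_
          linarith
        calc ‖∫ y in B, (⟪timeDeriv W s y - W s y - fderiv ℝ (W s) y y, f s y - g s y⟫ +
              frobeniusInner (fderiv ℝ (W s) y) (fderiv ℝ (f s) y - fderiv ℝ (g s) y))‖
            ≤ (MT + M + MD * (R + 1) + 3 * MD) * δ * (volume B).toReal := norm_setIntegral_le_of_norm_le_const hBfin hbd
          _ = ((MT + M + MD * (R + 1) + 3 * MD) * (volume B).toReal) * δ := by ring
      calc ‖∫ s in I, (lerayPairing W s (f s) - lerayPairing W s (g s))‖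
          ≤ ((MT + M + MD * (R + 1) + 3 * MD) * (volume B).toReal) * δ * (volume I).toReal :=
            norm_setIntegral_le_of_norm_le_const (by rw [hvolI]; exact ENNReal.ofReal_lt_top) hb
        _ = T * ((MT + M + MD * (R + 1) + 3 * MD) * (volume B).toReal) * δ := by
            rw [hvolI, ENNReal.toReal_ofReal hT.le]; ring
    -- combine
    rw [eΛf]
    have e : (∫ z, (⟪Ul z.1 z.2, timeDeriv f z.1 z.2⟫ - frobeniusInner (Gu z.1 z.2) (fderiv ℝ (f z.1) z.2) +
        ⟪Ul z.1 z.2 + Gu z.1 z.2 z.2 - Gu z.1 z.2 (W z.1 z.2 + mollify η ε Ul z.1 z.2) -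
          fderiv ℝ (W z.1) z.2 (Ul z.1 z.2) - fderiv ℝ (W z.1) z.2 (W z.1 z.2), f z.1 z.2⟫) ∂μQ) - ∫ s in I, lerayPairing W s (f s) =
        ((∫ z, (⟪Ul z.1 z.2, timeDeriv f z.1 z.2⟫ - frobeniusInner (Gu z.1 z.2) (fderiv ℝ (f z.1) z.2) +
        ⟪Ul z.1 z.2 + Gu z.1 z.2 z.2 - Gu z.1 z.2 (W z.1 z.2 + mollify η ε Ul z.1 z.2) -
          fderiv ℝ (W z.1) z.2 (Ul z.1 z.2) - fderiv ℝ (W z.1) z.2 (W z.1 z.2), f z.1 z.2⟫) ∂μQ) - ∫ z, (⟪Ul z.1 z.2, timeDeriv g z.1 z.2⟫ - frobeniusInner (Gu z.1 z.2) (fderiv ℝ (g z.1) z.2) +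
        ⟪Ul z.1 z.2 + Gu z.1 z.2 z.2 - Gu z.1 z.2 (W z.1 z.2 + mollify η ε Ul z.1 z.2) -
          fderiv ℝ (W z.1) z.2 (Ul z.1 z.2) - fderiv ℝ (W z.1) z.2 (W z.1 z.2), g z.1 z.2⟫) ∂μQ) -
          ((∫ s in I, lerayPairing W s (f s)) - ∫ s in I, lerayPairing W s (g s)) := by
      linarith [hΛg']
    rw [e]
    calc |((∫ z, (⟪Ul z.1 z.2, timeDeriv f z.1 z.2⟫ - frobeniusInner (Gu z.1 z.2) (fderiv ℝ (f z.1) z.2) +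
        ⟪Ul z.1 z.2 + Gu z.1 z.2 z.2 - Gu z.1 z.2 (W z.1 z.2 + mollify η ε Ul z.1 z.2) -
          fderiv ℝ (W z.1) z.2 (Ul z.1 z.2) - fderiv ℝ (W z.1) z.2 (W z.1 z.2), f z.1 z.2⟫) ∂μQ) - ∫ z, (⟪Ul z.1 z.2, timeDeriv g z.1 z.2⟫ - frobeniusInner (Gu z.1 z.2) (fderiv ℝ (g z.1) z.2) +
        ⟪Ul z.1 z.2 + Gu z.1 z.2 z.2 - Gu z.1 z.2 (W z.1 z.2 + mollify η ε Ul z.1 z.2) -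
          fderiv ℝ (W z.1) z.2 (Ul z.1 z.2) - fderiv ℝ (W z.1) z.2 (W z.1 z.2), g z.1 z.2⟫) ∂μQ) -
          ((∫ s in I, lerayPairing W s (f s)) - ∫ s in I, lerayPairing W s (g s))|
        ≤ |(∫ z, (⟪Ul z.1 z.2, timeDeriv f z.1 z.2⟫ - frobeniusInner (Gu z.1 z.2) (fderiv ℝ (f z.1) z.2) +
        ⟪Ul z.1 z.2 + Gu z.1 z.2 z.2 - Gu z.1 z.2 (W z.1 z.2 + mollify η ε Ul z.1 z.2) -
          fderiv ℝ (W z.1) z.2 (Ul z.1 z.2) - fderiv ℝ (W z.1) z.2 (W z.1 z.2), f z.1 z.2⟫) ∂μQ) - ∫ z, (⟪Ul z.1 z.2, timeDeriv g z.1 z.2⟫ - frobeniusInner (Gu z.1 z.2) (fderiv ℝ (g z.1) z.2) +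
        ⟪Ul z.1 z.2 + Gu z.1 z.2 z.2 - Gu z.1 z.2 (W z.1 z.2 + mollify η ε Ul z.1 z.2) -
          fderiv ℝ (W z.1) z.2 (Ul z.1 z.2) - fderiv ℝ (W z.1) z.2 (W z.1 z.2), g z.1 z.2⟫) ∂μQ| +
          |(∫ s in I, lerayPairing W s (f s)) - ∫ s in I, lerayPairing W s (g s)| := abs_sub _ _
      _ ≤ _ := by
          have e : ((∫ z, (‖Ul z.1 z.2‖ + 3 * ‖Gu z.1 z.2‖ + Φ z) ∂μQ) +
              T * ((MT + M + MD * (R + 1) + 3 * MD) * (volume B).toReal)) * δ =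
              (∫ z, (‖Ul z.1 z.2‖ + 3 * ‖Gu z.1 z.2‖ + Φ z) ∂μQ) * δ +
                T * ((MT + M + MD * (R + 1) + 3 * MD) * (volume B).toReal) * δ := by ring
          rw [e]
          exact add_le_add hbulk hprof
  exact eq_zero_of_abs_le_mul_of_forall_pos hest

end Closure

end BradshawTsai2017

end Literature.Analysis.FluidPDE

end
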